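import Mathlib
import Summits.Ventures.FusionMHD.Models.FluxSurfacePolarRayLevelGGJ
import HarnessLib

/-!
# Polar-ray chart, LEVEL direction (VI): the four Jardin (8.134) surface averages of an IMPLICIT flux surface as θ-integrals of
# named kernels, and the Mercier criterion on that surface as ONE polynomial inequality in SIX θ-integrals (`V′` and `q` cancel)

LADDER-GRIDFUSION (F2 item R2 / F1 on the Cerfon–Freidberg rung), cell `gridfusion`, seat `gridfusion-model-7` (g6), 2026-08-27.
Sixth file of «F2.R2-POLAR-LEVEL-DERIV»; part 2 of the (8.134) bookkeeping begun in `Models/FluxSurfacePolarRayLevelGGJ.lean`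
(`PolarRay.ggjData g C ψ R_c Z_c u : Mercier.FluxForm.SurfaceData`, conventions and the three-column framing stated there once:
label = level `u`, Jardin's orientation `Ψ′ = 2π`, `Ψ″ = 0`, constant `F ≡ g`, Solov'ev-class source `Δ*Ψ = C·R²`,
`σB² = gΔ*Ψ/R² ≡ C·g`, `B² = (g² + |∇Ψ|²)/R²`).

WHAT IS PROVED ([folklore] calculus + the printed functionals):
* §1 Four named kernels, each a multiple of the `V′`-kernel `volKernel = R·s/D` (`R = R_c + s cos θ`, `G = |∇ψ|²` along rays):
  `invGradKernel = volKernel/G`, `sigmaSqKernel = R²volKernel/((g² + G)G)`, `bsqGradKernel = (g² + G)volKernel/(R²G)`,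
  `invBsqKernel = R²volKernel/(g² + G)`, with joint continuity on boxes (for `LevelPanel.kernel_integral_tube`).
* §2 Under a `LevelLoop` with the Fréchet derivative `L θ s` of `ψ` on the boxes, `R > 0` there, the gradient-squared field
  `hG : ψ_R² + ψ_Z² = G` and the source `hGS : Δ*ψ = C·R²` on the boxes, for EVERY admissible level `u`:
  `point_facts` (`R > 0`, `|∇ψ|² = G`, `B² = (g² + G)/R²` at the surface point), `sigmaBsq_eq` (`gΔ*ψ/R² = C·g` there), and the
  four average fields of `ggjData`: `ggjData_gσB2 = C·g·∫invGradKernel ÷ ∫volKernel`, `ggjData_gσ2B2 = (C·g)²·∫sigmaSqKernel ÷ ∫volKernel`,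
  `ggjData_gB2 = ∫bsqGradKernel ÷ ∫volKernel`, `ggjData_invB2 = ∫invBsqKernel ÷ ∫volKernel` (Jardin (5.30) via
  `LevelLoop.surfaceAverageE_eq`).
* §3 **`mercierRegisterForm g C Pd Wd Aσ As AB Ai := g²Pd² + 4Cg²Pd·Aσ + 4C²g²(Aσ² − As·AB) − 4C²Ai·AB − 4C·Wd·AB`**, the
  algebraic lemma `mercierNumerator_eq_registerForm` (any `SurfaceData` with the §2 field shapes: `4V′²F = 4π²·mercierRegisterForm`,
  the `W = V′/2π = ∫volKernel` and `Φ′ = 2πq` registers CANCEL, `I′` multiplies `Ψ″ = 0`), **`mercierNumerator_ggjData`** with the six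
  registers `Pd = ∫polarKernelDs/D` (`= Φ″/g`), `Wd = ∫volKernelDs/D` (`= V″/2π`), `Aσ = ∫invGradKernel`, `As = ∫sigmaSqKernel`,
  `AB = ∫bsqGradKernel`, `Ai = ∫invBsqKernel` along `ρ_u`, and **`mercierCriterion_ggjData_iff`**: Jardin's criterion (8.134) on the
  implicit surface ⟺ `0 < mercierRegisterForm …` — SIX θ-integrals of explicit kernels along the certified radius and ONE polynomial
  inequality.  Each register is enclosed panel by panel by `LevelPanel.kernel_integral_tube` (Kernels file) from a program top
  register + a tube constant, so a CF-rung Mercier row needs no further analysis.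
MODELLED: ideal MHD, static axisymmetric equilibrium with constant `F` and `Δ*Ψ = C·R²`, nested star-shaped flux surfaces; the
criterion is NECESSARY for ideal interchange stability of the MODEL, not sufficient; never a device statement.  NOT CLAIMED: any
value for any equilibrium; that an instance's code lists are `∂_sψ`, `∂²_sψ`, `|∇ψ|²` beyond the hypotheses.
-/

noncomputable section

open Real Set Filter Topology MeasureTheory intervalIntegral
open Literature.MathematicalPhysics.MHD Literature.MathematicalPhysics.MHD.GradShafranov
  Literature.MathematicalPhysics.MHD.FluxGeometry Literature.MathematicalPhysics.MHD.Mercier.FluxForm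

namespace Summit.Ventures.FusionMHD.Models

namespace PolarRay

/-! ## §1 The four average kernels (multiples of the `V′`-kernel) -/

section kernels

variable {g Rc : ℝ} {D G : ℝ → ℝ → ℝ} {θ s : ℝ}

/-- Kernel of `V′⟨1/|∇ψ|²⟩/2π`: `volKernel/G` (`G = |∇ψ|²` along rays). [cite: Jardin2010, §8.5.4 eq. (8.134)] -/
def invGradKernel (Rc : ℝ) (D G : ℝ → ℝ → ℝ) (θ s : ℝ) : ℝ := volKernel Rc D θ s / G θ s

/-- Kernel of `V′⟨1/(B²|∇ψ|²)⟩/2π`: `R²·volKernel/((g² + G)·G)` (`B² = (g² + G)/R²`). [cite: Jardin2010, §8.5.4 eq. (8.134)] -/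
def sigmaSqKernel (g Rc : ℝ) (D G : ℝ → ℝ → ℝ) (θ s : ℝ) : ℝ :=
  (Rc + s * cos θ) ^ 2 * volKernel Rc D θ s / ((g ^ 2 + G θ s) * G θ s)

/-- Kernel of `V′⟨B²/|∇ψ|²⟩/2π`: `(g² + G)·volKernel/(R²·G)`. [cite: Jardin2010, §8.5.4 eq. (8.134)] -/
def bsqGradKernel (g Rc : ℝ) (D G : ℝ → ℝ → ℝ) (θ s : ℝ) : ℝ :=
  (g ^ 2 + G θ s) * volKernel Rc D θ s / ((Rc + s * cos θ) ^ 2 * G θ s)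

/-- Kernel of `V′⟨1/B²⟩/2π`: `R²·volKernel/(g² + G)`. [cite: Jardin2010, §8.5.4 eq. (8.134)] -/
def invBsqKernel (g Rc : ℝ) (D G : ℝ → ℝ → ℝ) (θ s : ℝ) : ℝ :=
  (Rc + s * cos θ) ^ 2 * volKernel Rc D θ s / (g ^ 2 + G θ s)

/-- Joint continuity of `invGradKernel` on a box where `D ≠ 0`, `G ≠ 0`. [folklore] -/
theorem continuousOn_invGradKernel {K : Set (ℝ × ℝ)} (hDc : ContinuousOn (fun p : ℝ × ℝ => D p.1 p.2) K)
    (hGc : ContinuousOn (fun p : ℝ × ℝ => G p.1 p.2) K) (hD0 : ∀ p ∈ K, D p.1 p.2 ≠ 0) (hG0 : ∀ p ∈ K, G p.1 p.2 ≠ 0) :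
    ContinuousOn (fun p : ℝ × ℝ => invGradKernel Rc D G p.1 p.2) K := by
  unfold invGradKernel
  exact (continuousOn_volKernel hDc hD0).div hGc hG0

/-- Joint continuity of `sigmaSqKernel` (`D ≠ 0`, `G ≠ 0`, `g² + G ≠ 0`). [folklore] -/
theorem continuousOn_sigmaSqKernel {K : Set (ℝ × ℝ)} (hDc : ContinuousOn (fun p : ℝ × ℝ => D p.1 p.2) K)
    (hGc : ContinuousOn (fun p : ℝ × ℝ => G p.1 p.2) K) (hD0 : ∀ p ∈ K, D p.1 p.2 ≠ 0) (hG0 : ∀ p ∈ K, G p.1 p.2 ≠ 0)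
    (hgG : ∀ p ∈ K, g ^ 2 + G p.1 p.2 ≠ 0) :
    ContinuousOn (fun p : ℝ × ℝ => sigmaSqKernel g Rc D G p.1 p.2) K := by
  unfold sigmaSqKernel
  refine ContinuousOn.div ?_ ?_ fun p hp => mul_ne_zero (hgG p hp) (hG0 p hp)
  · exact (by fun_prop : ContinuousOn (fun p : ℝ × ℝ => (Rc + p.2 * cos p.1) ^ 2) K).mul (continuousOn_volKernel hDc hD0)
  · exact ((by fun_prop : ContinuousOn (fun p : ℝ × ℝ => g ^ 2) K).add hGc).mul hGc

/-- Joint continuity of `bsqGradKernel` (`D ≠ 0`, `G ≠ 0`, `R ≠ 0`). [folklore] -/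
theorem continuousOn_bsqGradKernel {K : Set (ℝ × ℝ)} (hDc : ContinuousOn (fun p : ℝ × ℝ => D p.1 p.2) K)
    (hGc : ContinuousOn (fun p : ℝ × ℝ => G p.1 p.2) K) (hD0 : ∀ p ∈ K, D p.1 p.2 ≠ 0) (hG0 : ∀ p ∈ K, G p.1 p.2 ≠ 0)
    (hR : ∀ p ∈ K, Rc + p.2 * cos p.1 ≠ 0) :
    ContinuousOn (fun p : ℝ × ℝ => bsqGradKernel g Rc D G p.1 p.2) K := by
  unfold bsqGradKernel
  refine ContinuousOn.div ?_ ?_ fun p hp => mul_ne_zero (pow_ne_zero 2 (hR p hp)) (hG0 p hp)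
  · exact ((by fun_prop : ContinuousOn (fun p : ℝ × ℝ => g ^ 2) K).add hGc).mul (continuousOn_volKernel hDc hD0)
  · exact (by fun_prop : ContinuousOn (fun p : ℝ × ℝ => (Rc + p.2 * cos p.1) ^ 2) K).mul hGc

/-- Joint continuity of `invBsqKernel` (`D ≠ 0`, `g² + G ≠ 0`). [folklore] -/
theorem continuousOn_invBsqKernel {K : Set (ℝ × ℝ)} (hDc : ContinuousOn (fun p : ℝ × ℝ => D p.1 p.2) K)
    (hGc : ContinuousOn (fun p : ℝ × ℝ => G p.1 p.2) K) (hD0 : ∀ p ∈ K, D p.1 p.2 ≠ 0)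
    (hgG : ∀ p ∈ K, g ^ 2 + G p.1 p.2 ≠ 0) :
    ContinuousOn (fun p : ℝ × ℝ => invBsqKernel g Rc D G p.1 p.2) K := by
  unfold invBsqKernel
  refine ContinuousOn.div ?_ ((by fun_prop : ContinuousOn (fun p : ℝ × ℝ => g ^ 2) K).add hGc) hgG
  exact (by fun_prop : ContinuousOn (fun p : ℝ × ℝ => (Rc + p.2 * cos p.1) ^ 2) K).mul (continuousOn_volKernel hDc hD0)

end kernels

/-! ## §2 The four averages of `ggjData` along a loop of level panels -/

namespace LevelLoop

variable {ψ : ℝ → ℝ → ℝ} {Rc Zc uin uout : ℝ} {D D₁ G : ℝ → ℝ → ℝ} {N : ℕ} {t σ₁ σ₂ : ℕ → ℝ}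
  {L : ℝ → ℝ → (ℝ × ℝ →L[ℝ] ℝ)}

/-- **POINT FACTS ON AN ADMISSIBLE SURFACE**: at `γθ = (R_c + ρ_u θ cos θ, Z_c + ρ_u θ sin θ)`, `θ ∈ [0, 2π]`: `R > 0`,
`|∇ψ|² = G(θ, ρ_u θ)` and `B² = (g² + G)/R²` (constant `F ≡ g`). [folklore] -/
theorem point_facts (Λ : LevelLoop ψ Rc Zc uin uout D N t σ₁ σ₂) (g : ℝ)
    (hψ : ∀ j < N, ∀ θ ∈ Icc (t j) (t (j + 1)), ∀ s ∈ Icc (σ₁ j) (σ₂ j),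
      HasFDerivAt (fun p : ℝ × ℝ => ψ p.1 p.2) (L θ s) (rayPoint Rc Zc θ s))
    (hR : ∀ j < N, ∀ θ ∈ Icc (t j) (t (j + 1)), ∀ s ∈ Icc (σ₁ j) (σ₂ j), 0 < Rc + s * cos θ)
    (hG : ∀ j < N, ∀ θ ∈ Icc (t j) (t (j + 1)), ∀ s ∈ Icc (σ₁ j) (σ₂ j), (L θ s (1, 0)) ^ 2 + (L θ s (0, 1)) ^ 2 = G θ s)
    {u : ℝ} (hu : u ∈ Ioo uin uout) {θ : ℝ} (hθ : θ ∈ Icc 0 (2 * π)) :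
    0 < Rc + rayRadius ψ Rc Zc u θ * cos θ
      ∧ gradSq ψ (Rc + rayRadius ψ Rc Zc u θ * cos θ) (Zc + rayRadius ψ Rc Zc u θ * sin θ) = G θ (rayRadius ψ Rc Zc u θ)
      ∧ fieldBsq (fun _ => g) ψ (Rc + rayRadius ψ Rc Zc u θ * cos θ) (Zc + rayRadius ψ Rc Zc u θ * sin θ)
          = (g ^ 2 + G θ (rayRadius ψ Rc Zc u θ)) / (Rc + rayRadius ψ Rc Zc u θ * cos θ) ^ 2 := by
  obtain ⟨j, hj, hθj⟩ := Λ.exists_panel hθ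
  have hmem : rayRadius ψ Rc Zc u θ ∈ Icc (σ₁ j) (σ₂ j) := Ioo_subset_Icc_self ((Λ.panel j hj).spec hu hθj).1
  have hψ' := hψ j hj θ hθj _ hmem
  have hRpos := hR j hj θ hθj _ hmem
  have hgrad : gradSq ψ (Rc + rayRadius ψ Rc Zc u θ * cos θ) (Zc + rayRadius ψ Rc Zc u θ * sin θ)
      = G θ (rayRadius ψ Rc Zc u θ) := by
    rw [gradSq_of_hasFDerivAt hψ', hG j hj θ hθj _ hmem]
  exact ⟨hRpos, hgrad, by rw [fieldBsq_const ψ _ hRpos.ne', hgrad]⟩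

/-- On an admissible surface `gΔ*ψ/R² = C·g` (from `Δ*ψ = C·R²` on the boxes and `R > 0`): `σB²` is a surface constant.
[folklore] -/
theorem sigmaBsq_eq (Λ : LevelLoop ψ Rc Zc uin uout D N t σ₁ σ₂) (g : ℝ) {C : ℝ}
    (hR : ∀ j < N, ∀ θ ∈ Icc (t j) (t (j + 1)), ∀ s ∈ Icc (σ₁ j) (σ₂ j), 0 < Rc + s * cos θ)
    (hGS : ∀ j < N, ∀ θ ∈ Icc (t j) (t (j + 1)), ∀ s ∈ Icc (σ₁ j) (σ₂ j),
      gsOperator ψ (Rc + s * cos θ) (Zc + s * sin θ) = C * (Rc + s * cos θ) ^ 2)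
    {u : ℝ} (hu : u ∈ Ioo uin uout) {θ : ℝ} (hθ : θ ∈ Icc 0 (2 * π)) :
    g * gsOperator ψ (Rc + rayRadius ψ Rc Zc u θ * cos θ) (Zc + rayRadius ψ Rc Zc u θ * sin θ)
        / (Rc + rayRadius ψ Rc Zc u θ * cos θ) ^ 2 = C * g := by
  obtain ⟨j, hj, hθj⟩ := Λ.exists_panel hθ
  have hmem : rayRadius ψ Rc Zc u θ ∈ Icc (σ₁ j) (σ₂ j) := Ioo_subset_Icc_self ((Λ.panel j hj).spec hu hθj).1
  have hRpos := hR j hj θ hθj _ hmem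
  rw [hGS j hj θ hθj _ hmem]
  field_simp

/-- `⟨σB²/|∇Ψ|²⟩ = C·g · ∫₀^{2π} invGradKernel ÷ ∫₀^{2π} volKernel`. [cite: Jardin2010, §8.5.4 eq. (8.134)] -/
theorem ggjData_gσB2 (Λ : LevelLoop ψ Rc Zc uin uout D N t σ₁ σ₂) (g : ℝ) {C : ℝ}
    (hψ : ∀ j < N, ∀ θ ∈ Icc (t j) (t (j + 1)), ∀ s ∈ Icc (σ₁ j) (σ₂ j),
      HasFDerivAt (fun p : ℝ × ℝ => ψ p.1 p.2) (L θ s) (rayPoint Rc Zc θ s))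
    (hR : ∀ j < N, ∀ θ ∈ Icc (t j) (t (j + 1)), ∀ s ∈ Icc (σ₁ j) (σ₂ j), 0 < Rc + s * cos θ)
    (hG : ∀ j < N, ∀ θ ∈ Icc (t j) (t (j + 1)), ∀ s ∈ Icc (σ₁ j) (σ₂ j), (L θ s (1, 0)) ^ 2 + (L θ s (0, 1)) ^ 2 = G θ s)
    (hGS : ∀ j < N, ∀ θ ∈ Icc (t j) (t (j + 1)), ∀ s ∈ Icc (σ₁ j) (σ₂ j),
      gsOperator ψ (Rc + s * cos θ) (Zc + s * sin θ) = C * (Rc + s * cos θ) ^ 2)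
    {u : ℝ} (hu : u ∈ Ioo uin uout) :
    (ggjData g C ψ Rc Zc u).gσB2
      = C * g * ((∫ θ in (0 : ℝ)..(2 * π), invGradKernel Rc D G θ (rayRadius ψ Rc Zc u θ))
          / ∫ θ in (0 : ℝ)..(2 * π), volKernel Rc D θ (rayRadius ψ Rc Zc u θ)) := by
  have hI : uIcc 0 (2 * π) = Icc 0 (2 * π) := uIcc_of_le two_pi_pos.le
  show surfaceAverageE ψ _ _ _ = _
  rw [surfaceAverageE_of_const_mul (k := C * g) (b := fun R Z => 1 / gradSq ψ R Z) fun θ hθ => by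
    rw [hI] at hθ; simp only [loop]; rw [Λ.sigmaBsq_eq g hR hGS hu hθ, one_div, div_eq_mul_inv]]
  rw [Λ.surfaceAverageE_eq hψ hR hu]
  congr 2
  apply intervalIntegral.integral_congr
  intro θ hθ
  rw [hI] at hθ
  simp only [loop]
  rw [(Λ.point_facts g hψ hR hG hu hθ).2.1]
  unfold invGradKernel
  rw [one_div, inv_mul_eq_div]

/-- `⟨σ²B²/|∇Ψ|²⟩ = (C·g)² · ∫₀^{2π} sigmaSqKernel ÷ ∫₀^{2π} volKernel`. [cite: Jardin2010, §8.5.4 eq. (8.134)] -/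
theorem ggjData_gσ2B2 (Λ : LevelLoop ψ Rc Zc uin uout D N t σ₁ σ₂) (g : ℝ) {C : ℝ}
    (hψ : ∀ j < N, ∀ θ ∈ Icc (t j) (t (j + 1)), ∀ s ∈ Icc (σ₁ j) (σ₂ j),
      HasFDerivAt (fun p : ℝ × ℝ => ψ p.1 p.2) (L θ s) (rayPoint Rc Zc θ s))
    (hR : ∀ j < N, ∀ θ ∈ Icc (t j) (t (j + 1)), ∀ s ∈ Icc (σ₁ j) (σ₂ j), 0 < Rc + s * cos θ)
    (hG : ∀ j < N, ∀ θ ∈ Icc (t j) (t (j + 1)), ∀ s ∈ Icc (σ₁ j) (σ₂ j), (L θ s (1, 0)) ^ 2 + (L θ s (0, 1)) ^ 2 = G θ s)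
    (hGS : ∀ j < N, ∀ θ ∈ Icc (t j) (t (j + 1)), ∀ s ∈ Icc (σ₁ j) (σ₂ j),
      gsOperator ψ (Rc + s * cos θ) (Zc + s * sin θ) = C * (Rc + s * cos θ) ^ 2)
    {u : ℝ} (hu : u ∈ Ioo uin uout) :
    (ggjData g C ψ Rc Zc u).gσ2B2
      = (C * g) ^ 2 * ((∫ θ in (0 : ℝ)..(2 * π), sigmaSqKernel g Rc D G θ (rayRadius ψ Rc Zc u θ))
          / ∫ θ in (0 : ℝ)..(2 * π), volKernel Rc D θ (rayRadius ψ Rc Zc u θ)) := by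
  have hI : uIcc 0 (2 * π) = Icc 0 (2 * π) := uIcc_of_le two_pi_pos.le
  show surfaceAverageE ψ _ _ _ = _
  rw [surfaceAverageE_of_const_mul (k := (C * g) ^ 2)
    (b := fun R Z => 1 / (fieldBsq (fun _ => g) ψ R Z * gradSq ψ R Z)) fun θ hθ => by
    rw [hI] at hθ; simp only [loop]; rw [Λ.sigmaBsq_eq g hR hGS hu hθ, one_div, div_eq_mul_inv]]
  rw [Λ.surfaceAverageE_eq hψ hR hu]
  congr 2
  apply intervalIntegral.integral_congr
  intro θ hθ
  rw [hI] at hθ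
  obtain ⟨hRpos, hgrad, hB⟩ := Λ.point_facts g hψ hR hG hu hθ
  have hDpos : 0 < D θ (rayRadius ψ Rc Zc u θ) := (Λ.surface_facts hu hθ).2.2.2
  simp only [loop]
  rw [hB, hgrad]
  unfold sigmaSqKernel volKernel
  have hRne := hRpos.ne'
  field_simp

/-- `⟨B²/|∇Ψ|²⟩ = ∫₀^{2π} bsqGradKernel ÷ ∫₀^{2π} volKernel`. [cite: Jardin2010, §8.5.4 eq. (8.134)] -/
theorem ggjData_gB2 (Λ : LevelLoop ψ Rc Zc uin uout D N t σ₁ σ₂) (g C : ℝ)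
    (hψ : ∀ j < N, ∀ θ ∈ Icc (t j) (t (j + 1)), ∀ s ∈ Icc (σ₁ j) (σ₂ j),
      HasFDerivAt (fun p : ℝ × ℝ => ψ p.1 p.2) (L θ s) (rayPoint Rc Zc θ s))
    (hR : ∀ j < N, ∀ θ ∈ Icc (t j) (t (j + 1)), ∀ s ∈ Icc (σ₁ j) (σ₂ j), 0 < Rc + s * cos θ)
    (hG : ∀ j < N, ∀ θ ∈ Icc (t j) (t (j + 1)), ∀ s ∈ Icc (σ₁ j) (σ₂ j), (L θ s (1, 0)) ^ 2 + (L θ s (0, 1)) ^ 2 = G θ s)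
    {u : ℝ} (hu : u ∈ Ioo uin uout) :
    (ggjData g C ψ Rc Zc u).gB2
      = (∫ θ in (0 : ℝ)..(2 * π), bsqGradKernel g Rc D G θ (rayRadius ψ Rc Zc u θ))
          / ∫ θ in (0 : ℝ)..(2 * π), volKernel Rc D θ (rayRadius ψ Rc Zc u θ) := by
  have hI : uIcc 0 (2 * π) = Icc 0 (2 * π) := uIcc_of_le two_pi_pos.le
  show surfaceAverageE ψ _ _ _ = _
  rw [Λ.surfaceAverageE_eq hψ hR hu]
  congr 1
  apply intervalIntegral.integral_congr
  intro θ hθ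
  rw [hI] at hθ
  obtain ⟨hRpos, hgrad, hB⟩ := Λ.point_facts g hψ hR hG hu hθ
  simp only [loop]
  rw [hB, hgrad]
  unfold bsqGradKernel
  have hRne := hRpos.ne'
  field_simp

/-- `⟨1/B²⟩ = ∫₀^{2π} invBsqKernel ÷ ∫₀^{2π} volKernel`. [cite: Jardin2010, §8.5.4 eq. (8.134)] -/
theorem ggjData_invB2 (Λ : LevelLoop ψ Rc Zc uin uout D N t σ₁ σ₂) (g C : ℝ)
    (hψ : ∀ j < N, ∀ θ ∈ Icc (t j) (t (j + 1)), ∀ s ∈ Icc (σ₁ j) (σ₂ j),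
      HasFDerivAt (fun p : ℝ × ℝ => ψ p.1 p.2) (L θ s) (rayPoint Rc Zc θ s))
    (hR : ∀ j < N, ∀ θ ∈ Icc (t j) (t (j + 1)), ∀ s ∈ Icc (σ₁ j) (σ₂ j), 0 < Rc + s * cos θ)
    (hG : ∀ j < N, ∀ θ ∈ Icc (t j) (t (j + 1)), ∀ s ∈ Icc (σ₁ j) (σ₂ j), (L θ s (1, 0)) ^ 2 + (L θ s (0, 1)) ^ 2 = G θ s)
    {u : ℝ} (hu : u ∈ Ioo uin uout) :
    (ggjData g C ψ Rc Zc u).invB2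
      = (∫ θ in (0 : ℝ)..(2 * π), invBsqKernel g Rc D G θ (rayRadius ψ Rc Zc u θ))
          / ∫ θ in (0 : ℝ)..(2 * π), volKernel Rc D θ (rayRadius ψ Rc Zc u θ) := by
  have hI : uIcc 0 (2 * π) = Icc 0 (2 * π) := uIcc_of_le two_pi_pos.le
  show surfaceAverageE ψ _ _ _ = _
  rw [Λ.surfaceAverageE_eq hψ hR hu]
  congr 1
  apply intervalIntegral.integral_congr
  intro θ hθ
  rw [hI] at hθ
  obtain ⟨hRpos, -, hB⟩ := Λ.point_facts g hψ hR hG hu hθ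
  simp only [loop]
  rw [hB]
  unfold invBsqKernel
  have hRne := hRpos.ne'
  field_simp

end LevelLoop

/-! ## §3 The criterion on the implicit surface as ONE inequality in six registers -/

/-- **THE REGISTER FORM OF JARDIN'S NUMERATOR** on a Solov'ev-class implicit surface: with `Pd = ∫polarKernelDs/D` (`= Φ″/g`),
`Wd = ∫volKernelDs/D` (`= V″/2π`), `Aσ = ∫invGradKernel`, `As = ∫sigmaSqKernel`, `AB = ∫bsqGradKernel`, `Ai = ∫invBsqKernel`:
`mercierRegisterForm = g²Pd² + 4Cg²Pd·Aσ + 4C²g²(Aσ² − As·AB) − 4C²Ai·AB − 4C·Wd·AB`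
(`4V′²F = 4π²·mercierRegisterForm`, `mercierNumerator_ggjData`). [cite: Jardin2010, §8.5.4 eq. (8.134)] -/
def mercierRegisterForm (g C Pd Wd Aσ As AB Ai : ℝ) : ℝ :=
  g ^ 2 * Pd ^ 2 + 4 * C * g ^ 2 * Pd * Aσ + 4 * C ^ 2 * g ^ 2 * (Aσ ^ 2 - As * AB) - 4 * C ^ 2 * Ai * AB
    - 4 * C * Wd * AB

/-- Algebra of the register form: if `V′ = 2πW`, `V″ = 2πWd`, `Ψ′ = 2π`, `Ψ″ = 0`, `Φ″ = gPd`, `K′ = 0`, `p′ = −C` and the four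
averages are `CgAσ/W`, `(Cg)²As/W`, `AB/W`, `Ai/W` with `W ≠ 0`, then `mercierNumerator = 4π²·mercierRegisterForm` — the
`W = V′/2π` and `Φ′` registers cancel and `I′` multiplies `Ψ″ = 0`. [cite: Jardin2010, §8.5.4 eq. (8.134)] -/
theorem mercierNumerator_eq_registerForm (d : SurfaceData) {g C W Wd Pd Aσ As AB Ai : ℝ} (hW : W ≠ 0)
    (hV : d.V' = 2 * π * W) (hV2 : d.V'' = 2 * π * Wd) (hΨ1 : d.Ψ' = 2 * π) (hΨ2 : d.Ψ'' = 0) (hΦ2 : d.Φ'' = g * Pd)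
    (hK : d.K' = 0) (hp : d.p' = -C) (hσ : d.gσB2 = C * g * (Aσ / W)) (hσ2 : d.gσ2B2 = (C * g) ^ 2 * (As / W))
    (hB : d.gB2 = AB / W) (hi : d.invB2 = Ai / W) :
    d.mercierNumerator = 4 * π ^ 2 * mercierRegisterForm g C Pd Wd Aσ As AB Ai := by
  unfold SurfaceData.mercierNumerator SurfaceData.shear mercierRegisterForm
  rw [hV, hV2, hΨ1, hΨ2, hΦ2, hK, hp, hσ, hσ2, hB, hi]
  field_simp
  ring

namespace LevelLoop

variable {ψ : ℝ → ℝ → ℝ} {Rc Zc uin uout : ℝ} {D D₁ G : ℝ → ℝ → ℝ} {N : ℕ} {t σ₁ σ₂ : ℕ → ℝ}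
  {L : ℝ → ℝ → (ℝ × ℝ →L[ℝ] ℝ)}

/-- **`4V′²F = 4π² · mercierRegisterForm` OF THE SIX θ-INTEGRALS** `Pd = ∫polarKernelDs/D`, `Wd = ∫volKernelDs/D`,
`Aσ = ∫invGradKernel`, `As = ∫sigmaSqKernel`, `AB = ∫bsqGradKernel`, `Ai = ∫invBsqKernel` along `ρ_u`, for every admissible
level of a loop of level panels (hypotheses: `hψ` Fréchet derivative on the boxes, `hR` `R > 0`, `hD₁`/`hD₁c` second ray
derivative, `hG` gradient-squared field, `hGS` `Δ*ψ = C·R²`). [cite: Jardin2010, §8.5.4 eq. (8.134)] -/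
theorem mercierNumerator_ggjData (Λ : LevelLoop ψ Rc Zc uin uout D N t σ₁ σ₂) (g : ℝ) {C : ℝ}
    (hψ : ∀ j < N, ∀ θ ∈ Icc (t j) (t (j + 1)), ∀ s ∈ Icc (σ₁ j) (σ₂ j),
      HasFDerivAt (fun p : ℝ × ℝ => ψ p.1 p.2) (L θ s) (rayPoint Rc Zc θ s))
    (hR : ∀ j < N, ∀ θ ∈ Icc (t j) (t (j + 1)), ∀ s ∈ Icc (σ₁ j) (σ₂ j), 0 < Rc + s * cos θ)
    (hD₁ : ∀ j < N, ∀ θ ∈ Icc (t j) (t (j + 1)), ∀ s ∈ Icc (σ₁ j) (σ₂ j), HasDerivAt (D θ) (D₁ θ s) s)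
    (hD₁c : ∀ j < N, ContinuousOn (fun p : ℝ × ℝ => D₁ p.1 p.2) (Icc (t j) (t (j + 1)) ×ˢ Icc (σ₁ j) (σ₂ j)))
    (hG : ∀ j < N, ∀ θ ∈ Icc (t j) (t (j + 1)), ∀ s ∈ Icc (σ₁ j) (σ₂ j), (L θ s (1, 0)) ^ 2 + (L θ s (0, 1)) ^ 2 = G θ s)
    (hGS : ∀ j < N, ∀ θ ∈ Icc (t j) (t (j + 1)), ∀ s ∈ Icc (σ₁ j) (σ₂ j),
      gsOperator ψ (Rc + s * cos θ) (Zc + s * sin θ) = C * (Rc + s * cos θ) ^ 2)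
    {u : ℝ} (hu : u ∈ Ioo uin uout) :
    (ggjData g C ψ Rc Zc u).mercierNumerator
      = 4 * π ^ 2 * mercierRegisterForm g C
          (∫ θ in (0 : ℝ)..(2 * π), polarKernelDs Rc D D₁ θ (rayRadius ψ Rc Zc u θ) / D θ (rayRadius ψ Rc Zc u θ))
          (∫ θ in (0 : ℝ)..(2 * π), volKernelDs Rc D D₁ θ (rayRadius ψ Rc Zc u θ) / D θ (rayRadius ψ Rc Zc u θ))
          (∫ θ in (0 : ℝ)..(2 * π), invGradKernel Rc D G θ (rayRadius ψ Rc Zc u θ))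
          (∫ θ in (0 : ℝ)..(2 * π), sigmaSqKernel g Rc D G θ (rayRadius ψ Rc Zc u θ))
          (∫ θ in (0 : ℝ)..(2 * π), bsqGradKernel g Rc D G θ (rayRadius ψ Rc Zc u θ))
          (∫ θ in (0 : ℝ)..(2 * π), invBsqKernel g Rc D G θ (rayRadius ψ Rc Zc u θ)) :=
  mercierNumerator_eq_registerForm _ (Λ.integral_volKernel_pos hψ hR hu).ne'
    (Λ.ggjData_V' g C hψ hR hu) (Λ.ggjData_V'' g C hψ hR hD₁ hD₁c hu) rfl rfl (Λ.ggjData_Φ'' g C hψ hR hD₁ hD₁c hu) rfl rfl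
    (Λ.ggjData_gσB2 g hψ hR hG hGS hu) (Λ.ggjData_gσ2B2 g hψ hR hG hGS hu) (Λ.ggjData_gB2 g C hψ hR hG hu)
    (Λ.ggjData_invB2 g C hψ hR hG hu)

/-- **JARDIN'S MERCIER CRITERION (8.134) ON THE IMPLICIT SURFACE ⟺ ONE POLYNOMIAL INEQUALITY IN SIX θ-INTEGRALS**:
`MercierCriterion (ggjData g C ψ R_c Z_c u) ↔ 0 < mercierRegisterForm g C Pd Wd Aσ As AB Ai` with the registers of
`mercierNumerator_ggjData` (`F = N/(4V′²)`, `V′ > 0`).  Each register is the integral over `[0, 2π]` of an EXPLICIT kernel along the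
certified radius, enclosed panel by panel by `LevelPanel.kernel_integral_tube` from a program register + a tube constant; the
criterion is NECESSARY for ideal interchange stability of the MODEL, never a device statement. [cite: Jardin2010, §8.5.4 eq. (8.134)] -/
theorem mercierCriterion_ggjData_iff (Λ : LevelLoop ψ Rc Zc uin uout D N t σ₁ σ₂) (g : ℝ) {C : ℝ}
    (hψ : ∀ j < N, ∀ θ ∈ Icc (t j) (t (j + 1)), ∀ s ∈ Icc (σ₁ j) (σ₂ j),
      HasFDerivAt (fun p : ℝ × ℝ => ψ p.1 p.2) (L θ s) (rayPoint Rc Zc θ s))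
    (hR : ∀ j < N, ∀ θ ∈ Icc (t j) (t (j + 1)), ∀ s ∈ Icc (σ₁ j) (σ₂ j), 0 < Rc + s * cos θ)
    (hD₁ : ∀ j < N, ∀ θ ∈ Icc (t j) (t (j + 1)), ∀ s ∈ Icc (σ₁ j) (σ₂ j), HasDerivAt (D θ) (D₁ θ s) s)
    (hD₁c : ∀ j < N, ContinuousOn (fun p : ℝ × ℝ => D₁ p.1 p.2) (Icc (t j) (t (j + 1)) ×ˢ Icc (σ₁ j) (σ₂ j)))
    (hG : ∀ j < N, ∀ θ ∈ Icc (t j) (t (j + 1)), ∀ s ∈ Icc (σ₁ j) (σ₂ j), (L θ s (1, 0)) ^ 2 + (L θ s (0, 1)) ^ 2 = G θ s)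
    (hGS : ∀ j < N, ∀ θ ∈ Icc (t j) (t (j + 1)), ∀ s ∈ Icc (σ₁ j) (σ₂ j),
      gsOperator ψ (Rc + s * cos θ) (Zc + s * sin θ) = C * (Rc + s * cos θ) ^ 2)
    {u : ℝ} (hu : u ∈ Ioo uin uout) :
    (ggjData g C ψ Rc Zc u).MercierCriterion ↔
      0 < mercierRegisterForm g C
          (∫ θ in (0 : ℝ)..(2 * π), polarKernelDs Rc D D₁ θ (rayRadius ψ Rc Zc u θ) / D θ (rayRadius ψ Rc Zc u θ))
          (∫ θ in (0 : ℝ)..(2 * π), volKernelDs Rc D D₁ θ (rayRadius ψ Rc Zc u θ) / D θ (rayRadius ψ Rc Zc u θ))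
          (∫ θ in (0 : ℝ)..(2 * π), invGradKernel Rc D G θ (rayRadius ψ Rc Zc u θ))
          (∫ θ in (0 : ℝ)..(2 * π), sigmaSqKernel g Rc D G θ (rayRadius ψ Rc Zc u θ))
          (∫ θ in (0 : ℝ)..(2 * π), bsqGradKernel g Rc D G θ (rayRadius ψ Rc Zc u θ))
          (∫ θ in (0 : ℝ)..(2 * π), invBsqKernel g Rc D G θ (rayRadius ψ Rc Zc u θ)) := by
  rw [SurfaceData.mercierCriterion_iff_numerator_pos _ (Λ.ggjData_V'_pos g C hψ hR hu).ne',
    Λ.mercierNumerator_ggjData g hψ hR hD₁ hD₁c hG hGS hu]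
  have h4 : (0 : ℝ) < 4 * π ^ 2 := by positivity
  exact ⟨fun h => pos_of_mul_pos_right h h4.le, fun h => mul_pos h4 h⟩

end LevelLoop

end PolarRay

end Summit.Ventures.FusionMHD.Models

end
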